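import Summits.QuantumFields.YangMills.Theorems.BalabanUVNodesK0TwoPrimeOfLipschitzCollar

/-!
# K0⁷ — DIRECTOR-YM №432's NODE IN ONE THEOREM: «2′ ⟸ (W₁) NODE O's |β|-BOXES AT ONE FIXED RADIUS ā ALONG A COFINAL FAMILY OF (2.9)-THRESHOLDS» + N07's standard slots
# + the continuity row (cofinal) + the (8)-row beyond Theorem 1's ceiling — ALL PER-RADIUS NUMERICS ABSORBED (the door chooses `ε₂₉(a₀)` and `ρ(a₀)` itself)

Cell `pub-ymgap`, width seat `pub-ymgap-dag-n07-w3` (g20; N07 [B11] ∕ K0⁷ junction).  `--kind proof --supports stmt-QuantumFields-20541 --as helper`, COUNT-NEUTRAL.  NEW leaf;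
theorems only — 0 `def`, 0 `sorry`, 0 `instance`, 0 `notation`.  Imports this seat's g20 file 3 `…K0TwoPrimeOfLipschitzCollar` (door `absBetaBoxGZBAt_of_boxAtRadius_of_lipschitz`:
[15]-side bill = `hT1`∕`hUk`∕`h11`∕`hLip`, (I) derived; per text radius: numerics on `(ρ, ε₂₉)` + box + continuity + selector).  [I] = [Balaban1987RG1]; [15] = [Balaban1985Variational].

WHY.  Director-ym №432 (on CRIT-1 g32's sheet `Cruxes/Record13SepCoPHInhabited/CRIT-1-R2-seat3-radius-collapse-g32.md`): the node of record for seat -3's reshaping is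
«2′ ⟸ (W₁) ∧ (T) two-sided», (W₁) = «∃-box for `betaZB F ā ε₂₉` at the FIXED background radius `ā` along a COFINAL family of (2.9)-thresholds `ε₂₉ → 0` (each with its own γ₀, β′)».
Files 1–3 of this generation turned (T) into N07's standard slots + the Lipschitz row; but their doors still handed the producer, PER TEXT RADIUS `a₀`, a regularity letter `ρ` and a
threshold `ε₂₉` to choose under thirteen numeric rows.  Those rows are all MONOTONE in `(ρ, ε₂₉)` and the only `a₀`-dependence is the downward selector `ρ ≤ a₀`; so the door can choose
`ε₂₉(a₀) := min εmax (a₀ ∕ c)` and `ρ := c·ε₂₉` with `c := 80·B_L·L⁴ + 1` (the collar floor `ρ∕L² + B_L·60L⁴ε₂₉ ≤ ρ` holds for this `c` because `L² ≥ 4`), ONCE `εmax` satisfies the nine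
DOOR-LEVEL smallness rows.  What the producer then owes is LITERALLY (W₁): boxes at `ā` for every `ε₂₉ ∈ (0, εmax]` — plus the continuity row for every such `ε₂₉`, and the (8)-row for text
radii beyond the ceiling `α₀` (stated for every admissible `ρ`).  THIS FILE is that theorem: ★★★★ `absBetaBoxGZBAt_of_cofinalBoxes`.

HONEST FRAMING (binding).  A by-name composition + real arithmetic; NO β estimate; nothing of Bałaban's asserted.  DISPLAYED: `hT1` (Thm 1 at objects), `hUk` (₈a rows, radii `[ā, α₀]`), `h11`
((1.1), radii `[ā, α₀]`), `hLip` (Lipschitz stability of the first form, [15] Prop. 9 species) — levels `k ≥ 1` = Bałaban's theorems, proved NOWHERE in the tree; `hbox` = NODE O's WALL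
([I] Thm 3 β-clause p. 264 at one background radius, re-run for every threshold `ε₂₉ ≤ εmax` — print-assembled in Literature, record instance + discharges OWED, director №435); `hT` = the
row-P7 ∕ K0e analytic-inclusion species on the plaquette ball, cofinal in `ε₂₉`; `hceil` = the (8)-row at text radii `a₀ > α₀` (there the text's [15] antecedent is nobody's theorem); numerics on
`(ā, εmax)`.  None is discharged here.  Stub 2′ OPEN; K0⁷ stmt-QuantumFields-20541 NOT closed; N07 NOT discharged; COUNT 8∕28 · K 1∕4 UNMOVED; R4 = the CONDITIONAL finite-𝕋⁴ rung
`BalabanLadder.UV` at fixed `ε = L^(−K)` only — NOT continuum ∕ ℝ⁴ ∕ OS; the Yang–Mills mass gap (Clay) is NOT proved by any of this.  Standard axioms only.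
-/

noncomputable section

open MeasureTheory Set Filter Topology
open scoped Matrix.Norms.L2Operator

namespace Summit.QuantumFields.YangMills.BalabanUVNodes.K0TwoPrimeOfCofinalBoxes

open Literature.MathematicalPhysics.QuantumFieldTheory.Balaban1983to89
open Literature.MathematicalPhysics.QuantumFieldTheory.Balaban1983to89.Node00
open Literature.MathematicalPhysics.QuantumFieldTheory.Balaban1983to89.T4Continuum
open Literature.MathematicalPhysics.QuantumFieldTheory.Balaban1983to89.FlowStep
open Literature.MathematicalPhysics.QuantumFieldTheory.Balaban1983to89.B15DeterminingSets
open Literature.MathematicalPhysics.QuantumFieldTheory.Balaban1983to89.ExpMeanLog (deltaSU deltaSU_pos)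
open Literature.MathematicalPhysics.QuantumFieldTheory.Balaban1983to89.B12GaugeOrbits021 (OrbitRel)
open B12Eq019ActionBody (integrand)
open Summit.QuantumFields.YangMills.Theorems.K0V23Defs (AbsBetaBoxAtThm1WitnessCCMGenGridGZBAt)
open Summit.QuantumFields.YangMills.BalabanUVNodes.K0TwoPrimeOfLipschitzCollar (absBetaBoxGZBAt_of_boxAtRadius_of_lipschitz)

section Door

variable (F : T4Family)

/-- ★★★★ **2′ FROM COFINAL BOXES AT ONE FIXED RADIUS** (director-ym №432's node, kernel form, per-radius numerics absorbed).  DOOR LEVEL: radius `0 < ā < α₀` with `ā < α` in Berge's window;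
threshold `0 < δ₁₁ ≤ α₁`, `B·δ₁₁ ≤ ā`; constants `B, B_L ≥ 0`, `t_L, r_L`; a threshold ceiling `εmax > 0` with NINE smallness rows (writing `c := 80·B_L·L⁴ + 1`): the [B7] (53) pair at `c·εmax`,
`2c·εmax ≤ δ₁₁`, `2c·εmax ≤ α₁`, `2B·c·εmax ≤ ā`, the rider pair `1640·(12L·εmax + 18ā)·L⁶ ≤ 1`, `13·(12L·εmax + 18ā)·L³ < δ_{SU(2)}`, `60L⁴εmax ≤ t_L`, `c·εmax∕L² ≤ r_L`; N07's slots
`hT1` (Thm 1 at objects), `hUk` (₈a rows, radii `[ā, α₀]`), `h11` ((1.1) on `PlaqSmall δ₁₁`, radii `[ā, α₀]`), `hLip` (Lipschitz stability of the first form).  PRODUCER: (W₁) `hbox` — for EVERY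
`ε₂₉ ∈ (0, εmax]` a box `−β′ ≤ β₁₃(F; ā, ε₂₉) ≤ β′` on some `]0, γ₀]` at the zero member; `hT` — for every such `ε₂₉` the continuity row on the plaquette ball; `hceil` — for text radii `a₀ > α₀`
carrying the [15] antecedents, the (8)-row at `a₀` on the first form of ANY membership `ρ` with `0 < ρ`, `2Bρ ≤ ā`.  THEN `K0V23Defs.AbsBetaBoxAtThm1WitnessCCMGenGridGZBAt F`.  Proof: file 3's
door with `ε₂₉(a₀) := min εmax (a₀∕c)`, `ρ := c·ε₂₉(a₀)`; the thirteen per-radius rows follow from the nine door-level ones by monotonicity, the collar floor from `L² ≥ 4`, the selector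
alternative by trichotomy of `a₀` against `ā` and `α₀`.  CONDITIONAL on every displayed row; NO β estimate; nothing of Bałaban's asserted.
[cite: Balaban1987RG1, Thm 1 p.259, Thm 3 p.264, (1.20)–(1.22) p.264, (1.1)–(1.2) p.260, p.259, (2.3) p.265, (2.9) p.266 and p.267; Balaban1985Variational, Thm 1 (6),(8)–(10) p.279, Prop. 7 p.299, Prop. 9 p.309; Balaban1985Averaging, Prop. 2 (53) p.26 (bookkeeping)] -/
theorem absBetaBoxGZBAt_of_cofinalBoxes (ā δ₁₁ α₀ α₁ B α tL rL BL εmax : ℝ) (hā : 0 < ā) (hāα₀ : ā < α₀) (hB : 0 ≤ B) (hBL : 0 ≤ BL)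
    (hδ₁₁ : 0 < δ₁₁) (hδα₁ : δ₁₁ ≤ α₁) (hBδ : B * δ₁₁ ≤ ā)
    (hāα : ā < α) (hα3 : 143 * 256 * α ≤ 1 / 3) (hα2 : 2 * α ≤ 2 * deltaSU (Fin 2) / (8 * (F.L : ℝ)) ^ 2)
    (hα24 : 9 * (F.L : ℝ) ^ 2 * (2 * α) ≤ 1 / 24) (hαL : 157 * (9 * (F.L : ℝ) ^ 2 * (2 * α)) < ((F.L : ℝ) ^ 3)⁻¹)
    (hεmax : 0 < εmax)
    (hε53a : 143 * 256 * ((80 * BL * (F.L : ℝ) ^ 4 + 1) * εmax) ≤ 1 / 3)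
    (hε53b : 2 * ((80 * BL * (F.L : ℝ) ^ 4 + 1) * εmax) ≤ 2 * deltaSU (Fin 2) / (8 * (F.L : ℝ)) ^ 2)
    (hεδ : 2 * ((80 * BL * (F.L : ℝ) ^ 4 + 1) * εmax) ≤ δ₁₁) (hεα₁ : 2 * ((80 * BL * (F.L : ℝ) ^ 4 + 1) * εmax) ≤ α₁)
    (hεB : 2 * B * ((80 * BL * (F.L : ℝ) ^ 4 + 1) * εmax) ≤ ā)
    (hεn1 : 1640 * (12 * (F.L : ℝ) * εmax + 18 * ā) * (F.L : ℝ) ^ 6 ≤ 1) (hεn2 : 13 * (12 * (F.L : ℝ) * εmax + 18 * ā) * (F.L : ℝ) ^ 3 < deltaSU (Fin 2))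
    (hεtL : 60 * (F.L : ℝ) ^ 4 * εmax ≤ tL) (hεrL : (80 * BL * (F.L : ℝ) ^ 4 + 1) * εmax / (F.L : ℝ) ^ 2 ≤ rL)
    (hT1 : ∀ (K k : ℕ) (ε₁ : ℝ), 0 < ε₁ → ε₁ ≤ α₁ → ∀ V : GaugeField (F.P K) k (Node00.SU 2), PlaqSmall ε₁ V →
      (∃ U : GaugeField (F.P K) 0 (Node00.SU 2), IsBackground (avOfRecord F 2 K) {U | InUkClassB11 F 2 K k (B * ε₁) U} k V U) ∧
      (∀ ε₀ : ℝ, B * ε₁ ≤ ε₀ → ε₀ ≤ α₀ → ∀ U U' : GaugeField (F.P K) 0 (Node00.SU 2),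
          IsBackground (avOfRecord F 2 K) {U | InUkClassB11 F 2 K k (B * ε₁) U} k V U →
          IsBackground (avOfRecord F 2 K) {U | InUkClassB11 F 2 K k ε₀ U} k V U' → InUkClassB11 F 2 K k ε₀ U ∧ OrbitRel k U U'))
    (hUk : ∀ (K k : ℕ) (ε : ℝ), ā ≤ ε → ε ≤ α₀ → ∀ (V : GaugeField (F.P K) k (Node00.SU 2)) (δ : ℝ), 0 < δ → δ ≤ α₁ → B * δ ≤ ε → PlaqSmall δ V →
      UkExists F 2 K k ε V ∧ InUkClassB11 F 2 K k ε (Uk F 2 K k ε V))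
    (h11 : ∀ (K k : ℕ) (ε : ℝ), ā ≤ ε → ε ≤ α₀ → ∀ V : GaugeField (F.P K) k (Node00.SU 2), PlaqSmall δ₁₁ V → UkExists F 2 K k ε V ∧ UniqueUkOrbit F 2 K k ε V)
    (hLip : ∀ (K k : ℕ) (V V' : GaugeField (F.P K) k (Node00.SU 2)) (t r : ℝ), 0 ≤ t → t ≤ tL → 0 < r → r ≤ rL →
      (∀ b, dist1 ((V' b)⁻¹ * V b) ≤ t) →
      (UkExists F 2 K k ā V' ∧ ∀ U₁, IsBackground (avOfRecord F 2 K) (bgReg F 2 K k ā) k V' U₁ → U₁ ∈ bgReg F 2 K k r) →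
      (UkExists F 2 K k ā V ∧ ∀ U₁, IsBackground (avOfRecord F 2 K) (bgReg F 2 K k ā) k V U₁ → U₁ ∈ bgReg F 2 K k (r + BL * t)))
    (hbox : ∀ ε₂₉ : ℝ, 0 < ε₂₉ → ε₂₉ ≤ εmax → ∃ γ₀ β' : ℝ, 0 < γ₀ ∧
      BetaLowerH (-β') γ₀ (betaOfRecord₁₃ F 2 (theta13OfThm1CCMWZB F 2 0 (1 / 2) ā 0 ε₂₉ 0 0 ā 0 (fun _ _ => 0) (fun _ _ => 0))) ∧
      BetaUpperH β' γ₀ (betaOfRecord₁₃ F 2 (theta13OfThm1CCMWZB F 2 0 (1 / 2) ā 0 ε₂₉ 0 0 ā 0 (fun _ _ => 0) (fun _ _ => 0))))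
    (hT : ∀ ε₂₉ : ℝ, 0 < ε₂₉ → ε₂₉ ≤ εmax → ∀ K (g : ℕ → ℝ) k, k < K →
      {V : GaugeField (F.P K) (k + 1) (Node00.SU 2) | PlaqSmall δ₁₁ V} ⊆ regSetOfRecord F 2 K k
        (integrand (chiFixed29 F 2 (numerics7OfThm1CCM F.L 0 0 0 0 ā 0) ε₂₉ K g k) (gfOfRecord F 2 K k) (g k)
          (effActionHT F 2 (TcanOfRecord F 2) (chiFixed29 F 2 (numerics7OfThm1CCM F.L 0 0 0 0 ā 0) ε₂₉) K g k)))
    (hceil : ∀ a₀ : ℝ, α₀ < a₀ →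
      (∃ (j c c₀ c₁ : ℕ) (B₃ B₃' a₁ : ℝ), c ≤ F.L ^ j ∧ c₀ ≤ j + 1 ∧ c₁ ≤ j ∧ 2 * (F.L : ℝ) ^ 2 ≤ B₃ ∧ 0 < B₃' ∧ 0 < a₁ ∧
        VariationalThm1RegSepCoP7MGB F 2
          (fun ν M g K k _s => c ≤ ν.M₁ ∧ k + c₀ ≤ F.m + K ∧ F.L ^ c₁ ∣ M ∧
            ∀ i, 1 ≤ i → i ≤ k → dCubeSide (F.P K).L M (RkOfRecord (F.P K).L ν.r (g i)) i ∣ (F.P K).sitesPerDir 0) (lamDatum F) (dataSmall7LamTopOf F 2) B₃ a₀ a₁ ∧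
        Gauge9RegSepTopStepGB F 2 (fun ν K Ω => suppDomOfRecord F ν K Ω) (F.L ^ j)
          (fun ν M g K k _s => c ≤ ν.M₁ ∧ k + c₀ ≤ F.m + K ∧ F.L ^ c₁ ∣ M ∧
            ∀ i, 1 ≤ i → i ≤ k → dCubeSide (F.P K).L M (RkOfRecord (F.P K).L ν.r (g i)) i ∣ (F.P K).sitesPerDir 0) (lamDatum F) (dataSmall7LamTopOf F 2) B₃ B₃' a₀ a₁) →
      ∀ ρ : ℝ, 0 < ρ → 2 * B * ρ ≤ ā → ∀ K k (W : GaugeField (F.P K) (k + 1) (Node00.SU 2)), k < K →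
        (UkExists F 2 K (k + 1) ā W ∧ ∀ U₁, IsBackground (avOfRecord F 2 K) (bgReg F 2 K (k + 1) ā) (k + 1) W U₁ → U₁ ∈ bgReg F 2 K (k + 1) ρ) →
        UkExists F 2 K (k + 1) a₀ W ∧ ∀ U₁, IsBackground (avOfRecord F 2 K) (bgReg F 2 K (k + 1) a₀) (k + 1) W U₁ → U₁ ∈ bgReg F 2 K (k + 1) ā) :
    AbsBetaBoxAtThm1WitnessCCMGenGridGZBAt F := by
  have hL11 : (11 : ℝ) < (F.L : ℝ) := by exact_mod_cast F.hL11
  have hL0 : (0 : ℝ) < (F.L : ℝ) := by linarith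
  have hL4 : (4 : ℝ) ≤ (F.L : ℝ) ^ 2 := by nlinarith
  -- the door's constant `c := 80·B_L·L⁴ + 1`
  obtain ⟨c, hc⟩ : ∃ c : ℝ, c = 80 * BL * (F.L : ℝ) ^ 4 + 1 := ⟨_, rfl⟩
  have hcpos : 0 < c := by rw [hc]; positivity
  have hc1 : 1 ≤ c := by rw [hc]; linarith [show 0 ≤ 80 * BL * (F.L : ℝ) ^ 4 by positivity]
  refine absBetaBoxGZBAt_of_boxAtRadius_of_lipschitz F ā δ₁₁ α₀ α₁ B α tL rL BL hā hāα₀ hB hδ₁₁ hδα₁ hBδ hāα hα3 hα2 hα24 hαL hT1 hUk h11 hLip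
    fun a₀ ha₀ hant => ?_
  -- the threshold and the membership radius for this text radius
  obtain ⟨ε, hε⟩ : ∃ ε : ℝ, ε = min εmax (a₀ / c) := ⟨_, rfl⟩
  have hεpos : 0 < ε := by rw [hε]; exact lt_min hεmax (div_pos ha₀ hcpos)
  have hεle : ε ≤ εmax := by rw [hε]; exact min_le_left _ _
  have hεa₀ : ε ≤ a₀ / c := by rw [hε]; exact min_le_right _ _
  obtain ⟨γ₀, β', hγ₀, hlo, hup⟩ := hbox ε hεpos hεle
  have hρle : c * ε ≤ c * εmax := mul_le_mul_of_nonneg_left hεle hcpos.le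
  have hcε : c * εmax = (80 * BL * (F.L : ℝ) ^ 4 + 1) * εmax := by rw [hc]
  refine ⟨γ₀, ε, β', c * ε, hγ₀, hεpos, mul_pos hcpos hεpos, ?_, ?_, ?_, ?_, ?_, ?_, ?_, ?_, ?_, ?_, hlo, hup, hT ε hεpos hεle, ?_⟩
  · -- (53a)
    calc 143 * 256 * (c * ε) ≤ 143 * 256 * (c * εmax) := by gcongr
      _ ≤ 1 / 3 := by rw [hcε]; exact hε53a
  · -- (53b)
    calc 2 * (c * ε) ≤ 2 * (c * εmax) := by gcongr
      _ ≤ 2 * deltaSU (Fin 2) / (8 * (F.L : ℝ)) ^ 2 := by rw [hcε]; exact hε53b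
  · calc 2 * (c * ε) ≤ 2 * (c * εmax) := by gcongr
      _ ≤ δ₁₁ := by rw [hcε]; exact hεδ
  · calc 2 * (c * ε) ≤ 2 * (c * εmax) := by gcongr
      _ ≤ α₁ := by rw [hcε]; exact hεα₁
  · calc 2 * B * (c * ε) ≤ 2 * B * (c * εmax) := mul_le_mul_of_nonneg_left hρle (by positivity)
      _ ≤ ā := by rw [hcε]; exact hεB
  · -- rider, first row (monotone in `ε₂₉`)
    have h : 1640 * (12 * (F.L : ℝ) * ε + 18 * ā) * (F.L : ℝ) ^ 6 ≤ 1640 * (12 * (F.L : ℝ) * εmax + 18 * ā) * (F.L : ℝ) ^ 6 := by gcongr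
    exact h.trans hεn1
  · have h : 13 * (12 * (F.L : ℝ) * ε + 18 * ā) * (F.L : ℝ) ^ 3 ≤ 13 * (12 * (F.L : ℝ) * εmax + 18 * ā) * (F.L : ℝ) ^ 3 := by gcongr
    exact h.trans_lt hεn2
  · calc 60 * (F.L : ℝ) ^ 4 * ε ≤ 60 * (F.L : ℝ) ^ 4 * εmax := by gcongr
      _ ≤ tL := hεtL
  · calc c * ε / (F.L : ℝ) ^ 2 ≤ c * εmax / (F.L : ℝ) ^ 2 := by gcongr
      _ ≤ rL := by rw [hcε]; exact hεrL
  · -- the collar floor: `cε∕L² + B_L·60L⁴ε ≤ cε` because `L² ≥ 4` and `c = 80B_L L⁴ + 1`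
    have h1 : c * ε / (F.L : ℝ) ^ 2 ≤ c * ε / 4 := div_le_div_of_nonneg_left (by positivity) (by norm_num) hL4
    have h2 : BL * (60 * (F.L : ℝ) ^ 4 * ε) = 60 * (BL * (F.L : ℝ) ^ 4 * ε) := by ring
    have h3 : c * ε = 80 * (BL * (F.L : ℝ) ^ 4 * ε) + ε := by rw [hc]; ring
    have h4 : 0 ≤ BL * (F.L : ℝ) ^ 4 * ε := by positivity
    rw [h2]
    linarith
  · -- the selector alternative, by trichotomy of `a₀` against `ā` and `α₀`
    have hρa₀ : c * ε ≤ a₀ := by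
      calc c * ε ≤ c * (a₀ / c) := mul_le_mul_of_nonneg_left hεa₀ hcpos.le
        _ = a₀ := mul_div_cancel₀ a₀ hcpos.ne'
    rcases le_or_gt a₀ ā with hdown | hup'
    · exact Or.inl ⟨hdown, hρa₀⟩
    · rcases le_or_gt a₀ α₀ with hin | hout
      · exact Or.inr (Or.inl ⟨hup'.le, hin⟩)
      · refine Or.inr (Or.inr ⟨hup'.le, fun K k W hk hW => hceil a₀ hout hant (c * ε) (mul_pos hcpos hεpos) ?_ K k W hk hW⟩)
        calc 2 * B * (c * ε) ≤ 2 * B * (c * εmax) := mul_le_mul_of_nonneg_left hρle (by positivity)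
          _ ≤ ā := by rw [hcε]; exact hεB

end Door

/-! ## A6: the door-level `(ā, εmax)`-window is an inhabited range -/

section A6

variable {F : T4Family}

/-- **THE `εmax`-ROWS ARE AN INHABITED RANGE** for every `ā` small enough for the rider (`1640·18ā·L⁶ < 1`, `13·18ā·L³ < δ_{SU(2)}`), every `δ₁₁, α₁, t_L, r_L > 0` and `B, B_L ≥ 0`: some
`εmax > 0` satisfies the nine smallness rows of the door (all are upper bounds on `εmax`, the two rider rows having positive slack at `εmax = 0`).  With file 2's `openNumerics_inhabited`
(the `α`-window) this shows the door's numerics do not empty it. [cite: Balaban1985Averaging, Prop. 2 (52)–(53) p.26 (bookkeeping); Balaban1987RG1, p.267 (bookkeeping)] -/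
theorem cofinalNumerics_inhabited {ā δ₁₁ α₁ B tL rL BL : ℝ} (hā : 0 < ā) (hδ₁₁ : 0 < δ₁₁) (hα₁ : 0 < α₁) (hB : 0 ≤ B) (hBL : 0 ≤ BL)
    (htL : 0 < tL) (hrL : 0 < rL)
    (hn1 : 1640 * (18 * ā) * (F.L : ℝ) ^ 6 < 1) (hn2 : 13 * (18 * ā) * (F.L : ℝ) ^ 3 < deltaSU (Fin 2)) :
    ∃ εmax : ℝ, 0 < εmax ∧
      143 * 256 * ((80 * BL * (F.L : ℝ) ^ 4 + 1) * εmax) ≤ 1 / 3 ∧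
      2 * ((80 * BL * (F.L : ℝ) ^ 4 + 1) * εmax) ≤ 2 * deltaSU (Fin 2) / (8 * (F.L : ℝ)) ^ 2 ∧
      2 * ((80 * BL * (F.L : ℝ) ^ 4 + 1) * εmax) ≤ δ₁₁ ∧ 2 * ((80 * BL * (F.L : ℝ) ^ 4 + 1) * εmax) ≤ α₁ ∧
      2 * B * ((80 * BL * (F.L : ℝ) ^ 4 + 1) * εmax) ≤ ā ∧
      1640 * (12 * (F.L : ℝ) * εmax + 18 * ā) * (F.L : ℝ) ^ 6 ≤ 1 ∧ 13 * (12 * (F.L : ℝ) * εmax + 18 * ā) * (F.L : ℝ) ^ 3 < deltaSU (Fin 2) ∧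
      60 * (F.L : ℝ) ^ 4 * εmax ≤ tL ∧ (80 * BL * (F.L : ℝ) ^ 4 + 1) * εmax / (F.L : ℝ) ^ 2 ≤ rL := by
  have hL1 : (1 : ℝ) ≤ (F.L : ℝ) := by exact_mod_cast F.hL.2.le
  have hL0 : (0 : ℝ) < (F.L : ℝ) := by linarith
  have hdS : 0 < deltaSU (Fin 2) := deltaSU_pos
  obtain ⟨c, hc⟩ : ∃ c : ℝ, c = 80 * BL * (F.L : ℝ) ^ 4 + 1 := ⟨_, rfl⟩
  have hcpos : 0 < c := by rw [hc]; positivity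
  -- each row is `κ_i · εmax ≤ θ_i` with `κ_i > 0`, `θ_i > 0`: continuity at `0` gives a common `εmax`
  -- row bounds as explicit positive ceilings
  obtain ⟨e1, he1⟩ : ∃ e : ℝ, e = (1 / 3) / (143 * 256 * c) := ⟨_, rfl⟩
  obtain ⟨e2, he2⟩ : ∃ e : ℝ, e = (2 * deltaSU (Fin 2) / (8 * (F.L : ℝ)) ^ 2) / (2 * c) := ⟨_, rfl⟩
  obtain ⟨e3, he3⟩ : ∃ e : ℝ, e = δ₁₁ / (2 * c) := ⟨_, rfl⟩
  obtain ⟨e4, he4⟩ : ∃ e : ℝ, e = α₁ / (2 * c) := ⟨_, rfl⟩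
  obtain ⟨e5, he5⟩ : ∃ e : ℝ, e = ā / ((2 * B + 1) * c) := ⟨_, rfl⟩
  obtain ⟨e6, he6⟩ : ∃ e : ℝ, e = (1 - 1640 * (18 * ā) * (F.L : ℝ) ^ 6) / (1640 * 12 * (F.L : ℝ) ^ 7) := ⟨_, rfl⟩
  obtain ⟨e7, he7⟩ : ∃ e : ℝ, e = (deltaSU (Fin 2) - 13 * (18 * ā) * (F.L : ℝ) ^ 3) / (2 * (13 * 12 * (F.L : ℝ) ^ 4)) := ⟨_, rfl⟩
  obtain ⟨e8, he8⟩ : ∃ e : ℝ, e = tL / (60 * (F.L : ℝ) ^ 4) := ⟨_, rfl⟩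
  obtain ⟨e9, he9⟩ : ∃ e : ℝ, e = rL * (F.L : ℝ) ^ 2 / c := ⟨_, rfl⟩
  have h1 : 0 < e1 := by rw [he1]; positivity
  have h2 : 0 < e2 := by rw [he2]; positivity
  have h3 : 0 < e3 := by rw [he3]; positivity
  have h4 : 0 < e4 := by rw [he4]; positivity
  have h5 : 0 < e5 := by rw [he5]; positivity
  have h6 : 0 < e6 := by rw [he6]; exact div_pos (by linarith) (by positivity)
  have h7 : 0 < e7 := by rw [he7]; exact div_pos (by linarith) (by positivity)
  have h8 : 0 < e8 := by rw [he8]; positivity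
  have h9 : 0 < e9 := by rw [he9]; positivity
  obtain ⟨εmax, hε⟩ : ∃ ε : ℝ, ε = min (min (min e1 e2) (min e3 e4)) (min (min e5 e6) (min (min e7 e8) e9)) := ⟨_, rfl⟩
  have hεpos : 0 < εmax := by
    rw [hε]; exact lt_min (lt_min (lt_min h1 h2) (lt_min h3 h4)) (lt_min (lt_min h5 h6) (lt_min (lt_min h7 h8) h9))
  have l1 : εmax ≤ e1 := hε ▸ (min_le_left _ _).trans ((min_le_left _ _).trans (min_le_left _ _))
  have l2 : εmax ≤ e2 := hε ▸ (min_le_left _ _).trans ((min_le_left _ _).trans (min_le_right _ _))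
  have l3 : εmax ≤ e3 := hε ▸ (min_le_left _ _).trans ((min_le_right _ _).trans (min_le_left _ _))
  have l4 : εmax ≤ e4 := hε ▸ (min_le_left _ _).trans ((min_le_right _ _).trans (min_le_right _ _))
  have l5 : εmax ≤ e5 := hε ▸ (min_le_right _ _).trans ((min_le_left _ _).trans (min_le_left _ _))
  have l6 : εmax ≤ e6 := hε ▸ (min_le_right _ _).trans ((min_le_left _ _).trans (min_le_right _ _))
  have l7 : εmax ≤ e7 := hε ▸ (min_le_right _ _).trans ((min_le_right _ _).trans ((min_le_left _ _).trans (min_le_left _ _)))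
  have l8 : εmax ≤ e8 := hε ▸ (min_le_right _ _).trans ((min_le_right _ _).trans ((min_le_left _ _).trans (min_le_right _ _)))
  have l9 : εmax ≤ e9 := hε ▸ (min_le_right _ _).trans ((min_le_right _ _).trans (min_le_right _ _))
  refine ⟨εmax, hεpos, ?_, ?_, ?_, ?_, ?_, ?_, ?_, ?_, ?_⟩
  · rw [← hc]
    have := (le_div_iff₀ (by positivity : (0 : ℝ) < 143 * 256 * c)).1 (he1 ▸ l1)
    linarith
  · rw [← hc]
    have := (le_div_iff₀ (by positivity : (0 : ℝ) < 2 * c)).1 (he2 ▸ l2)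
    linarith
  · rw [← hc]
    have := (le_div_iff₀ (by positivity : (0 : ℝ) < 2 * c)).1 (he3 ▸ l3)
    linarith
  · rw [← hc]
    have := (le_div_iff₀ (by positivity : (0 : ℝ) < 2 * c)).1 (he4 ▸ l4)
    linarith
  · rw [← hc]
    have := (le_div_iff₀ (by positivity : (0 : ℝ) < (2 * B + 1) * c)).1 (he5 ▸ l5)
    nlinarith [mul_nonneg hcpos.le hεpos.le]
  · have := (le_div_iff₀ (by positivity : (0 : ℝ) < 1640 * 12 * (F.L : ℝ) ^ 7)).1 (he6 ▸ l6)
    nlinarith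
  · have := (le_div_iff₀ (by positivity : (0 : ℝ) < 2 * (13 * 12 * (F.L : ℝ) ^ 4))).1 (he7 ▸ l7)
    nlinarith
  · have := (le_div_iff₀ (by positivity : (0 : ℝ) < 60 * (F.L : ℝ) ^ 4)).1 (he8 ▸ l8)
    linarith
  · rw [← hc, div_le_iff₀ (by positivity)]
    have := (le_div_iff₀ hcpos).1 (he9 ▸ l9)
    linarith

end A6

end Summit.QuantumFields.YangMills.BalabanUVNodes.K0TwoPrimeOfCofinalBoxes
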